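import Mathlib
import HarnessLib.Audit
import Summits.PneNP.PneNP.Theorems.PstarChordReadFlip
import Summits.PneNP.PneNP.Theorems.PstarChordReadSwitches

/-!
# Outside-gated chords: partners, links, and the pointwise UNIFORM TYPE (ROUND-24, O1 at exact tightness; memo g21 §15)

FRONTIER range-avoidance ladder, rung F-N3, ROUND 24 (cell `pnp-ideate`, prover-2 memos `g20/O1-CHORD-READ-g20.md` §13–§14, `g21` §15 (the affine
two-chord theorem); typed target `PstarCoreBoundTargets.TerminalPeelable` (p646951); restricted-model proof complexity — nothing here bears on `P`
versus `NP`).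

At exact tightness every monomial of the readers `Γ₁, Γ₂` touching the AND pair of a chord `c` is a gate `(v, z)`: `v` a private of `c`, `z` OUTSIDE
the core (`PstarMaxSharingReaders.partner_fresh_of_tight`).  The g20 capstones classify such readings by the OTHER attachments of the partner `z`
(none / one `σ`-gate / one coupling).  The affine two-chord theorem (`PstarChordReadOutsideKill`) needs no such classification; this file sets up
its vocabulary and proves its first step.

* `partners I G z` — the other AND variables of the monomials of `G` containing `z`; `coef_eq_partners` / `mv_eq_partners`: the move of `(C, G)`
  under flipping `z` is the LINEAR G-constraint `[z ∈ C] ⊕ gval (partners G z) ∅` (so slice genericity applies to it);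
* `IsGate I J₀ c g v z` (an outside gate on `c`), `OutsideGated I J₀ 𝒢 c` (every monomial of the menu touching `c`'s AND pair is an outside
  gate), `Partner I J₀ 𝒢 c z`, `Unlinked I J₀ 𝒢 cᵢ cⱼ` (no common partner, no monomial coupling a partner of `cᵢ` with a partner of `cⱼ`);
* `mv_flip_gate` — flipping the private `v` of a gate `(v, z)` moves `mv z` by the gate's TYPE `([g ∈ G₁], [g ∈ G₂])`;
* `rank_one_out` / `rank_one_out_priv` — rank one (`PstarChordReadFlip.rank_one`) for two outside variables / an outside variable and a chord
  private whose co-private is `0`;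
* `type_eq` — **UNIFORM TYPE, pointwise**: two outside gates `(vᵢ, zᵢ)`, `(vⱼ, zⱼ)` on privates of two distinct chords, with `zᵢ, zⱼ` uncoupled and
  not partners of the other private, have EQUAL types — (T3) at the sixteen points `x ⊕ εᵢe_{vᵢ} ⊕ εⱼe_{vⱼ} ⊕ S`, `S ⊆ {zᵢ, zⱼ}`, of one solution
  with both co-privates `0`, via the four-point lemma.  No realisability hypothesis on the other attachments of `zᵢ, zⱼ` (memo g20 §13.8 needed
  "`σ` varies on the double slice"; here the other attachments are never looked at).

No genericity, no Assumption A.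
-/

set_option linter.dupNamespace false -- `Summit.PneNP.PneNP.…`: summit = sub-problem name (D-0017 single-conjunct layout)

open Finset Literature.Computability.Complexity
open Summit.PneNP.PneNP.Theorems.PstarFibrePolys (bit bit_injective bit_xor)
open Summit.PneNP.PneNP.Theorems.PstarTyped (Typed)
open Summit.PneNP.PneNP.Theorems.PstarSALevel (varSet bdry BoundaryExpanding SimpleOverlap)
open Summit.PneNP.PneNP.Theorems.PstarGapPeeling (not_mem_varSet_of_private)
open Summit.PneNP.PneNP.Theorems.PstarCentreFree (vars_mem_varSet)
open Summit.PneNP.PneNP.Theorems.PstarGapOneAll (gval)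
open Summit.PneNP.PneNP.Theorems.PstarGConstraint (bit_gval)
open Summit.PneNP.PneNP.Theorems.PstarChordRepair (IsChord)
open Summit.PneNP.PneNP.Theorems.PstarCoreBoundTargets (Terminal)
open Summit.PneNP.PneNP.Theorems.PstarChordBridgeTools (coef)
open Summit.PneNP.PneNP.Theorems.PstarChordReadSwitch (solves_update_of_outside)
open Summit.PneNP.PneNP.Theorems.PstarChordReadSwitches (Touches)
open Summit.PneNP.PneNP.Theorems.PstarChordReadFlip

namespace Summit.PneNP.PneNP.Theorems.PstarChordReadOutside

variable {n m : ℕ}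

/-! ## Partners: the move is a linear G-constraint -/
section Partners

variable (I : LocalMap 4 n m)

/-- The **PARTNERS** of `z` in `G`: the other AND variable of each monomial of `G` containing `z`. -/
def partners (G : Finset (Fin m)) (z : Fin n) : Finset (Fin n) :=
  (G.filter fun g => I.vars g 2 = z ∨ I.vars g 3 = z).image fun g => if I.vars g 2 = z then I.vars g 3 else I.vars g 2

/-- Membership in `partners`. -/
theorem mem_partners_iff (hI : I.IsPure xorAndPred) {G : Finset (Fin m)} {z u : Fin n} :
    u ∈ partners I G z ↔ ∃ g ∈ G, (I.vars g 2 = z ∧ I.vars g 3 = u) ∨ (I.vars g 2 = u ∧ I.vars g 3 = z) := by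
  unfold partners
  rw [mem_image]
  constructor
  · rintro ⟨g, hg, hu⟩
    rw [mem_filter] at hg
    refine ⟨g, hg.1, ?_⟩
    by_cases h2 : I.vars g 2 = z
    · rw [if_pos h2] at hu; exact Or.inl ⟨h2, hu⟩
    · rw [if_neg h2] at hu; exact Or.inr ⟨hu, hg.2.resolve_left h2⟩
  · rintro ⟨g, hg, h⟩
    have h23 : I.vars g 2 ≠ I.vars g 3 := fun e => absurd (hI.2 g e) (by decide)
    rcases h with ⟨h2, h3⟩ | ⟨h2, h3⟩
    · exact ⟨g, mem_filter.2 ⟨hg, Or.inl h2⟩, by rw [if_pos h2, h3]⟩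
    · have h2z : I.vars g 2 ≠ z := fun e => h23 (e.trans h3.symm)
      exact ⟨g, mem_filter.2 ⟨hg, Or.inr h3⟩, by rw [if_neg h2z, h2]⟩

/-- The AND pair of a monomial containing `z` is `{z, other}` with `other ≠ z`. -/
private theorem pair_other (hI : I.IsPure xorAndPred) {G : Finset (Fin m)} {g : Fin m} {z : Fin n}
    (hg : g ∈ G.filter fun g => I.vars g 2 = z ∨ I.vars g 3 = z) :
    ((I.vars g 2 = z ∧ I.vars g 3 = (if I.vars g 2 = z then I.vars g 3 else I.vars g 2)) ∨
      (I.vars g 2 = (if I.vars g 2 = z then I.vars g 3 else I.vars g 2) ∧ I.vars g 3 = z)) ∧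
      z ≠ (if I.vars g 2 = z then I.vars g 3 else I.vars g 2) := by
  have h23 : I.vars g 2 ≠ I.vars g 3 := fun e => absurd (hI.2 g e) (by decide)
  rw [mem_filter] at hg
  by_cases h2 : I.vars g 2 = z
  · rw [if_pos h2]; exact ⟨Or.inl ⟨h2, rfl⟩, fun e => h23 (h2.trans e)⟩
  · rw [if_neg h2]; exact ⟨Or.inr ⟨rfl, hg.2.resolve_left h2⟩, fun e => h2 e.symm⟩

/-- **The read coefficient of `z` is `[z ∈ C] + Σ_{u ∈ partners} X u`** (simple overlaps make the partner map injective). -/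
theorem coef_eq_partners (hI : I.IsPure xorAndPred) (hS : SimpleOverlap I) (C : Finset (Fin n)) (G : Finset (Fin m)) (z : Fin n)
    (X : Fin n → ZMod 2) : coef I C G z X = (if z ∈ C then 1 else 0) + ∑ u ∈ partners I G z, X u := by
  classical
  unfold coef partners
  congr 1
  rw [sum_image]
  · rw [sum_filter]
    refine sum_congr rfl fun g _ => ?_
    have h23 : I.vars g 2 ≠ I.vars g 3 := fun e => absurd (hI.2 g e) (by decide)
    by_cases h2 : I.vars g 2 = z
    · have h3 : I.vars g 3 ≠ z := fun e => h23 (h2.trans e.symm)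
      rw [if_pos h2, if_neg h3, if_pos (Or.inl h2), if_pos h2, add_zero]
    · by_cases h3 : I.vars g 3 = z
      · rw [if_neg h2, if_pos h3, if_pos (Or.inr h3), if_neg h2, zero_add]
      · rw [if_neg h2, if_neg h3, if_neg (by push Not; exact ⟨h2, h3⟩), add_zero]
  · intro g hg g' hg' heq
    obtain ⟨hp, hz⟩ := pair_other I hI (mem_coe.1 hg)
    obtain ⟨hp', -⟩ := pair_other I hI (mem_coe.1 hg')
    simp only at heq
    rw [heq] at hp hz
    exact eq_of_pair I hS hz hp hp'

/-- **The move under flipping `z` is the linear G-constraint `[z ∈ C] ⊕ gval (partners G z) ∅`.** -/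
theorem mv_eq_partners (hI : I.IsPure xorAndPred) (hS : SimpleOverlap I) (C : Finset (Fin n)) (G : Finset (Fin m)) (z : Fin n)
    (x : Fin n → Bool) : mv I C G z x = xor (decide (z ∈ C)) (gval I (partners I G z) ∅ x) := by
  unfold mv
  rw [coef_eq_partners I hI hS]
  have hg : (∑ u ∈ partners I G z, (fun w => bit (x w)) u) = bit (gval I (partners I G z) ∅ x) := by
    rw [bit_gval, sum_empty, add_zero]
  rw [hg]
  by_cases hz : z ∈ C
  · rw [if_pos hz, decide_eq_true hz]; cases gval I (partners I G z) ∅ x <;> decide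
  · rw [if_neg hz, decide_eq_false hz]; cases gval I (partners I G z) ∅ x <;> decide

end Partners

/-! ## Outside gates, partners of a chord, links -/
section Defs

variable (I : LocalMap 4 n m) (J₀ : Finset (Fin m)) (𝒢 : Finset (Fin m)) (c : Fin m)

/-- `g` is an **OUTSIDE GATE** on the chord `c` with private `v` and partner `z`: AND pair `{v, z}`, `v` a private of `c`, `z` in no output of the
core `J₀`.  (Nothing is said about the other monomials containing `z`, nor about the linear parts.) -/
def IsGate (g : Fin m) (v z : Fin n) : Prop :=
  (v = I.vars c 2 ∨ v = I.vars c 3) ∧ ((I.vars g 2 = v ∧ I.vars g 3 = z) ∨ (I.vars g 2 = z ∧ I.vars g 3 = v)) ∧ ∀ j ∈ J₀, z ∉ varSet I j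

/-- The chord `c` is **OUTSIDE-GATED** for the menu `𝒢`: every monomial of `𝒢` touching its AND pair is an outside gate on it.  Automatic at
exact tightness (`PstarMaxSharingReaders.partner_fresh_of_tight`). -/
def OutsideGated : Prop := ∀ g ∈ 𝒢, Touches I c g → ∃ v z, IsGate I J₀ c g v z

/-- `z` is a **PARTNER** of the chord `c`: the outside variable of an outside gate on `c` in the menu. -/
def Partner (z : Fin n) : Prop := ∃ g ∈ 𝒢, ∃ v, IsGate I J₀ c g v z

/-- The chords `cᵢ, cⱼ` are **UNLINKED**: no common partner, and no monomial of the menu couples a partner of `cᵢ` with a partner of `cⱼ`. -/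
def Unlinked (cᵢ cⱼ : Fin m) : Prop :=
  ∀ z z', Partner I J₀ 𝒢 cᵢ z → Partner I J₀ 𝒢 cⱼ z' →
    z ≠ z' ∧ ∀ h ∈ 𝒢, ¬ ((I.vars h 2 = z ∧ I.vars h 3 = z') ∨ (I.vars h 2 = z' ∧ I.vars h 3 = z))

variable {I J₀ 𝒢 c}

/-- An outside gate touches its chord. -/
theorem IsGate.touches {g : Fin m} {v z : Fin n} (h : IsGate I J₀ c g v z) : Touches I c g := by
  unfold PstarChordReadSwitches.Touches
  rcases h.1 with e | e <;> rcases h.2.1 with ⟨h2, h3⟩ | ⟨h2, h3⟩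
  · exact fun H => H.1.1 (h2.trans e)
  · exact fun H => H.1.2 (h3.trans e)
  · exact fun H => H.2.1 (h2.trans e)
  · exact fun H => H.2.2 (h3.trans e)

/-- The private of an outside gate is a variable of the chord; the partner is not (for `c ∈ J₀`), so they differ. -/
theorem IsGate.ne {g : Fin m} {v z : Fin n} (h : IsGate I J₀ c g v z) (hc : c ∈ J₀) : v ≠ z := by
  rcases h.1 with e | e <;> exact fun hvz => h.2.2 c hc (hvz ▸ e ▸ vars_mem_varSet I c _)

/-- A monomial with a private of `c` in an AND slot touches `c`. -/
theorem touches_of_slot {g : Fin m} {v : Fin n} (hv : v = I.vars c 2 ∨ v = I.vars c 3) (hg : I.vars g 2 = v ∨ I.vars g 3 = v) :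
    Touches I c g := by
  unfold PstarChordReadSwitches.Touches
  rcases hv with e | e <;> rcases hg with h | h
  · exact fun H => H.1.1 (h.trans e)
  · exact fun H => H.1.2 (h.trans e)
  · exact fun H => H.2.1 (h.trans e)
  · exact fun H => H.2.2 (h.trans e)

/-- **In an outside-gated chord, every monomial containing a private `v` of `c` is an outside gate `(v, z)`.** -/
theorem exists_gate_of_slot (hO : OutsideGated I J₀ 𝒢 c) (hc : c ∈ J₀) {g : Fin m} (hg : g ∈ 𝒢) {v : Fin n}
    (hv : v = I.vars c 2 ∨ v = I.vars c 3) (hgv : I.vars g 2 = v ∨ I.vars g 3 = v) : ∃ z, IsGate I J₀ c g v z := by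
  obtain ⟨v', z, hG⟩ := hO g hg (touches_of_slot hv hgv)
  have hz : z ≠ v := fun e => hG.2.2 c hc (by rw [e]; rcases hv with e' | e' <;> rw [e'] <;> exact vars_mem_varSet I c _)
  -- `v` is an AND variable of `g`, the pair is `{v', z}`, `z ≠ v`, so `v = v'`
  have hvv' : v = v' := by
    rcases hG.2.1 with ⟨h2, h3⟩ | ⟨h2, h3⟩ <;> rcases hgv with h | h
    · exact h.symm.trans h2
    · exact absurd (h.symm.trans h3).symm hz
    · exact absurd (h.symm.trans h2).symm hz
    · exact h.symm.trans h3
  subst hvv'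
  exact ⟨z, hG⟩

/-- **Links.**  If `z` is a partner of `cᵢ`, the chords are unlinked and `cⱼ` is outside-gated, then no monomial of the menu has AND pair `{z, v}` for a
private `v` of `cⱼ` (it would be an outside gate on `cⱼ` with partner `z`). -/
theorem no_pair_priv {cᵢ cⱼ : Fin m} (hU : Unlinked I J₀ 𝒢 cᵢ cⱼ) (hOⱼ : OutsideGated I J₀ 𝒢 cⱼ) (hcⱼ : cⱼ ∈ J₀) {z : Fin n}
    (hz : Partner I J₀ 𝒢 cᵢ z) {v : Fin n} (hv : v = I.vars cⱼ 2 ∨ v = I.vars cⱼ 3) :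
    ∀ h ∈ 𝒢, ¬ ((I.vars h 2 = v ∧ I.vars h 3 = z) ∨ (I.vars h 2 = z ∧ I.vars h 3 = v)) := by
  intro h hh H
  obtain ⟨g₀, hg₀, v₀, hg₀G⟩ := hz
  have hzout : ∀ j ∈ J₀, z ∉ varSet I j := hg₀G.2.2
  have hvmem : v ∈ varSet I cⱼ := by
    rcases hv with e | e <;> rw [e] <;> exact vars_mem_varSet I cⱼ _
  have hvz : v ≠ z := fun e => hzout cⱼ hcⱼ (e ▸ hvmem)
  have hgv : I.vars h 2 = v ∨ I.vars h 3 = v := by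
    rcases H with ⟨h2, -⟩ | ⟨-, h3⟩
    exacts [Or.inl h2, Or.inr h3]
  obtain ⟨z', hG⟩ := exists_gate_of_slot hOⱼ hcⱼ hh hv hgv
  -- the pair of `h` is `{v, z}` and `{v, z'}`: so `z = z'`, a partner of `cⱼ`
  have hzz' : z = z' := by
    rcases H with ⟨k2, k3⟩ | ⟨k2, k3⟩ <;> rcases hG.2.1 with ⟨g2, g3⟩ | ⟨g2, g3⟩
    · exact k3.symm.trans g3
    · exact absurd (g3.symm.trans k3) hvz
    · exact absurd (g2.symm.trans k2) hvz
    · exact k2.symm.trans g2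
  subst hzz'
  exact (hU z z ⟨g₀, hg₀, v₀, hg₀G⟩ ⟨h, hh, v, hG⟩).1 rfl

end Defs

/-! ## Moves under private flips; rank one with outside variables -/
section Moves

variable {I : LocalMap 4 n m} {r : ℕ} {y : Fin m → Bool} {J₀ : Finset (Fin m)} {w₁ w₂ : Finset (Fin n) × Finset (Fin m) × Bool}

/-- **Flipping the private of a gate moves `mv z` by the gate's membership bit.**  If `g` has AND pair `{v, z}` (`v ≠ z`), then for any `G`:
`mv (C, G) z (x ⊕ e_v) = mv (C, G) z x ⊕ [g ∈ G]`. -/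
theorem mv_flip_gate (hI : I.IsPure xorAndPred) (hS : SimpleOverlap I) (C : Finset (Fin n)) (G : Finset (Fin m)) {g : Fin m} {v z : Fin n}
    (hg : (I.vars g 2 = v ∧ I.vars g 3 = z) ∨ (I.vars g 2 = z ∧ I.vars g 3 = v)) (hvz : v ≠ z) (x : Fin n → Bool) :
    mv I C G z (Function.update x v (!x v)) = xor (mv I C G z x) (decide (g ∈ G)) := by
  classical
  by_cases hG : g ∈ G
  · rw [mv_update_of_gate I C G hI hS hG hg.symm x, decide_eq_true hG]
    cases mv I C G z x <;> rfl
  · rw [decide_eq_false hG, Bool.xor_false]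
    refine mv_update_of_ne I C G (fun h hh H => hG ?_) x (!x v)
    rwa [eq_of_pair I hS hvz.symm H hg.symm] at hh

/-- **Rank one for two outside variables** (`PstarChordReadFlip.rank_one` with the three flipped points solved automatically). -/
theorem rank_one_out (hI : I.IsPure xorAndPred) (ht : Terminal I r y J₀ w₁ w₂) {x : Fin n → Bool} {z z' : Fin n}
    (hz : ∀ j ∈ J₀, z ∉ varSet I j) (hz' : ∀ j ∈ J₀, z' ∉ varSet I j) (hzz : z ≠ z')
    (hno : ∀ g ∈ w₁.2.1 ∪ w₂.2.1, ¬ ((I.vars g 2 = z' ∧ I.vars g 3 = z) ∨ (I.vars g 2 = z ∧ I.vars g 3 = z')))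
    (hx : ∀ j ∈ J₀, I.eval x j = y j) :
    (mv I w₁.1 w₁.2.1 z x && mv I w₂.1 w₂.2.1 z' x) = (mv I w₁.1 w₁.2.1 z' x && mv I w₂.1 w₂.2.1 z x) :=
  rank_one hI ht hzz hno hx (solves_update_of_outside hz hx _) (solves_update_of_outside hz' hx _)
    (solves_update_of_outside hz' (solves_update_of_outside hz hx _) _)

/-- **Rank one for an outside variable and a chord private whose co-private is `0`.** -/
theorem rank_one_out_priv (hI : I.IsPure xorAndPred) (ht : Terminal I r y J₀ w₁ w₂) {x : Fin n → Bool} {z v v' : Fin n} {c : Fin m}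
    (hz : ∀ j ∈ J₀, z ∉ varSet I j) (hc : c ∈ J₀) (hch : IsChord I J₀ c)
    (hvv : (I.vars c 2 = v ∧ I.vars c 3 = v') ∨ (I.vars c 2 = v' ∧ I.vars c 3 = v))
    (hno : ∀ g ∈ w₁.2.1 ∪ w₂.2.1, ¬ ((I.vars g 2 = v ∧ I.vars g 3 = z) ∨ (I.vars g 2 = z ∧ I.vars g 3 = v)))
    (hx : ∀ j ∈ J₀, I.eval x j = y j) (h0 : x v' = false) :
    (mv I w₁.1 w₁.2.1 z x && mv I w₂.1 w₂.2.1 v x) = (mv I w₁.1 w₁.2.1 v x && mv I w₂.1 w₂.2.1 z x) := by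
  have hvmem : v ∈ varSet I c ∧ v' ∈ varSet I c := by
    rcases hvv with ⟨h2, h3⟩ | ⟨h2, h3⟩
    · exact ⟨h2 ▸ vars_mem_varSet I c 2, h3 ▸ vars_mem_varSet I c 3⟩
    · exact ⟨h3 ▸ vars_mem_varSet I c 3, h2 ▸ vars_mem_varSet I c 2⟩
  have hzv : z ≠ v := fun e => hz c hc (e ▸ hvmem.1)
  have hzv' : z ≠ v' := fun e => hz c hc (e ▸ hvmem.2)
  have hxz := solves_update_of_outside hz hx (!x z)
  have h0' : Function.update x z (!x z) v' = false := by rw [Function.update_of_ne hzv'.symm]; exact h0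
  exact rank_one hI ht hzv hno hx hxz (solves_update_priv hI hc hch hvv hx h0 _) (solves_update_priv hI hc hch hvv hxz h0' _)

end Moves

/-! ## Uniform type -/
section Types

variable {I : LocalMap 4 n m} {r : ℕ} {y : Fin m → Bool} {J₀ : Finset (Fin m)} {w₁ w₂ : Finset (Fin n) × Finset (Fin m) × Bool}
  {cᵢ cⱼ gᵢ gⱼ : Fin m} {vᵢ vᵢ' zᵢ vⱼ vⱼ' zⱼ : Fin n}

/-- **UNIFORM TYPE (pointwise, attachment-free).**  Two outside gates `gᵢ = (vᵢ, zᵢ)`, `gⱼ = (vⱼ, zⱼ)` on privates `vᵢ, vⱼ` of two distinct chords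
(`vᵢ', vⱼ'` the co-privates), with `zᵢ ≠ zⱼ` uncoupled, `zᵢ` in no monomial with `vⱼ` and `zⱼ` in none with `vᵢ`, and ONE solution of the core with
`x_{vᵢ'} = x_{vⱼ'} = 0`: then the gates have the same type `([g ∈ G₁], [g ∈ G₂])`. -/
theorem type_eq (hI : I.IsPure xorAndPred) (hS : SimpleOverlap I) (ht : Terminal I r y J₀ w₁ w₂) (hcᵢ : cᵢ ∈ J₀) (hcⱼ : cⱼ ∈ J₀)
    (hne : cᵢ ≠ cⱼ) (hchᵢ : IsChord I J₀ cᵢ) (hchⱼ : IsChord I J₀ cⱼ)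
    (hvᵢ : (I.vars cᵢ 2 = vᵢ ∧ I.vars cᵢ 3 = vᵢ') ∨ (I.vars cᵢ 2 = vᵢ' ∧ I.vars cᵢ 3 = vᵢ))
    (hvⱼ : (I.vars cⱼ 2 = vⱼ ∧ I.vars cⱼ 3 = vⱼ') ∨ (I.vars cⱼ 2 = vⱼ' ∧ I.vars cⱼ 3 = vⱼ))
    (hgᵢ : gᵢ ∈ w₁.2.1 ∪ w₂.2.1) (hpᵢ : (I.vars gᵢ 2 = vᵢ ∧ I.vars gᵢ 3 = zᵢ) ∨ (I.vars gᵢ 2 = zᵢ ∧ I.vars gᵢ 3 = vᵢ))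
    (hzᵢ : ∀ j ∈ J₀, zᵢ ∉ varSet I j)
    (hgⱼ : gⱼ ∈ w₁.2.1 ∪ w₂.2.1) (hpⱼ : (I.vars gⱼ 2 = vⱼ ∧ I.vars gⱼ 3 = zⱼ) ∨ (I.vars gⱼ 2 = zⱼ ∧ I.vars gⱼ 3 = vⱼ))
    (hzⱼ : ∀ j ∈ J₀, zⱼ ∉ varSet I j) (hzz : zᵢ ≠ zⱼ)
    (hnozz : ∀ h ∈ w₁.2.1 ∪ w₂.2.1, ¬ ((I.vars h 2 = zⱼ ∧ I.vars h 3 = zᵢ) ∨ (I.vars h 2 = zᵢ ∧ I.vars h 3 = zⱼ)))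
    (hnoᵢ : ∀ h ∈ w₁.2.1 ∪ w₂.2.1, ¬ ((I.vars h 2 = zᵢ ∧ I.vars h 3 = vⱼ) ∨ (I.vars h 2 = vⱼ ∧ I.vars h 3 = zᵢ)))
    (hnoⱼ : ∀ h ∈ w₁.2.1 ∪ w₂.2.1, ¬ ((I.vars h 2 = zⱼ ∧ I.vars h 3 = vᵢ) ∨ (I.vars h 2 = vᵢ ∧ I.vars h 3 = zⱼ)))
    {x : Fin n → Bool} (hx : ∀ j ∈ J₀, I.eval x j = y j) (h0ᵢ : x vᵢ' = false) (h0ⱼ : x vⱼ' = false) :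
    decide (gᵢ ∈ w₁.2.1) = decide (gⱼ ∈ w₁.2.1) ∧ decide (gᵢ ∈ w₂.2.1) = decide (gⱼ ∈ w₂.2.1) := by
  classical
  -- distinctness
  have memᵢ : vᵢ ∈ varSet I cᵢ ∧ vᵢ' ∈ varSet I cᵢ ∧ vᵢ ∈ bdry I J₀ := by
    rcases hvᵢ with ⟨h2, h3⟩ | ⟨h2, h3⟩
    · exact ⟨h2 ▸ vars_mem_varSet I cᵢ 2, h3 ▸ vars_mem_varSet I cᵢ 3, h2 ▸ hchᵢ.1⟩
    · exact ⟨h3 ▸ vars_mem_varSet I cᵢ 3, h2 ▸ vars_mem_varSet I cᵢ 2, h3 ▸ hchᵢ.2⟩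
  have memⱼ : vⱼ ∈ varSet I cⱼ ∧ vⱼ' ∈ varSet I cⱼ ∧ vⱼ ∈ bdry I J₀ := by
    rcases hvⱼ with ⟨h2, h3⟩ | ⟨h2, h3⟩
    · exact ⟨h2 ▸ vars_mem_varSet I cⱼ 2, h3 ▸ vars_mem_varSet I cⱼ 3, h2 ▸ hchⱼ.1⟩
    · exact ⟨h3 ▸ vars_mem_varSet I cⱼ 3, h2 ▸ vars_mem_varSet I cⱼ 2, h3 ▸ hchⱼ.2⟩
  have hvᵢⱼ' : vᵢ ≠ vⱼ' := fun e => not_mem_varSet_of_private I hcᵢ hcⱼ hne.symm memᵢ.2.2 memᵢ.1 (e ▸ memⱼ.2.1)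
  have hvⱼᵢ' : vⱼ ≠ vᵢ' := fun e => not_mem_varSet_of_private I hcⱼ hcᵢ hne memⱼ.2.2 memⱼ.1 (e ▸ memᵢ.2.1)
  have hvᵢⱼ : vᵢ ≠ vⱼ := fun e => not_mem_varSet_of_private I hcᵢ hcⱼ hne.symm memᵢ.2.2 memᵢ.1 (e ▸ memⱼ.1)
  have hvzᵢ : vᵢ ≠ zᵢ := fun e => hzᵢ cᵢ hcᵢ (e ▸ memᵢ.1)
  have hvzⱼ : vⱼ ≠ zⱼ := fun e => hzⱼ cⱼ hcⱼ (e ▸ memⱼ.1)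
  -- restrictions of the no-pair hypotheses to each reader
  have sub₁ : w₁.2.1 ⊆ w₁.2.1 ∪ w₂.2.1 := subset_union_left
  have sub₂ : w₂.2.1 ⊆ w₁.2.1 ∪ w₂.2.1 := subset_union_right
  -- the four points
  set x₁₀ := Function.update x vᵢ (!x vᵢ) with hx₁₀
  set x₀₁ := Function.update x vⱼ (!x vⱼ) with hx₀₁
  set x₁₁ := Function.update x₁₀ vⱼ (!x₁₀ vⱼ) with hx₁₁
  have hs₁₀ : ∀ j ∈ J₀, I.eval x₁₀ j = y j := solves_update_priv hI hcᵢ hchᵢ hvᵢ hx h0ᵢ _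
  have hs₀₁ : ∀ j ∈ J₀, I.eval x₀₁ j = y j := solves_update_priv hI hcⱼ hchⱼ hvⱼ hx h0ⱼ _
  have h0ⱼ' : x₁₀ vⱼ' = false := by rw [hx₁₀, Function.update_of_ne hvᵢⱼ'.symm]; exact h0ⱼ
  have hs₁₁ : ∀ j ∈ J₀, I.eval x₁₁ j = y j := solves_update_priv hI hcⱼ hchⱼ hvⱼ hs₁₀ h0ⱼ' _
  -- rank one at the four points
  have R₀₀ := rank_one_out hI ht hzᵢ hzⱼ hzz hnozz hx
  have R₁₀ := rank_one_out hI ht hzᵢ hzⱼ hzz hnozz hs₁₀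
  have R₀₁ := rank_one_out hI ht hzᵢ hzⱼ hzz hnozz hs₀₁
  have R₁₁ := rank_one_out hI ht hzᵢ hzⱼ hzz hnozz hs₁₁
  -- the moves at the four points
  have Aᵢ : ∀ (C : Finset (Fin n)) (G : Finset (Fin m)), mv I C G zᵢ x₁₀ = xor (mv I C G zᵢ x) (decide (gᵢ ∈ G)) :=
    fun C G => mv_flip_gate hI hS C G hpᵢ hvzᵢ x
  have Bⱼ : ∀ (C : Finset (Fin n)) (G : Finset (Fin m)), G ⊆ w₁.2.1 ∪ w₂.2.1 → mv I C G zⱼ x₁₀ = mv I C G zⱼ x :=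
    fun C G hG => mv_update_of_ne I C G (fun h hh => hnoⱼ h (hG hh)) x _
  have Aⱼ : ∀ (C : Finset (Fin n)) (G : Finset (Fin m)), mv I C G zⱼ x₀₁ = xor (mv I C G zⱼ x) (decide (gⱼ ∈ G)) :=
    fun C G => mv_flip_gate hI hS C G hpⱼ hvzⱼ x
  have Bᵢ : ∀ (C : Finset (Fin n)) (G : Finset (Fin m)), G ⊆ w₁.2.1 ∪ w₂.2.1 → mv I C G zᵢ x₀₁ = mv I C G zᵢ x :=
    fun C G hG => mv_update_of_ne I C G (fun h hh => hnoᵢ h (hG hh)) x _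
  have Cᵢ : ∀ (C : Finset (Fin n)) (G : Finset (Fin m)), G ⊆ w₁.2.1 ∪ w₂.2.1 →
      mv I C G zᵢ x₁₁ = xor (mv I C G zᵢ x) (decide (gᵢ ∈ G)) := fun C G hG => by
    rw [hx₁₁, mv_update_of_ne I C G (fun h hh => hnoᵢ h (hG hh)) x₁₀ _, Aᵢ C G]
  have Cⱼ : ∀ (C : Finset (Fin n)) (G : Finset (Fin m)), G ⊆ w₁.2.1 ∪ w₂.2.1 →
      mv I C G zⱼ x₁₁ = xor (mv I C G zⱼ x) (decide (gⱼ ∈ G)) := fun C G hG => by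
    rw [hx₁₁, mv_flip_gate hI hS C G hpⱼ hvzⱼ x₁₀, Bⱼ C G hG]
  rw [Aᵢ, Aᵢ, Bⱼ _ _ sub₁, Bⱼ _ _ sub₂] at R₁₀
  rw [Aⱼ, Aⱼ, Bᵢ _ _ sub₁, Bᵢ _ _ sub₂] at R₀₁
  rw [Cᵢ _ _ sub₁, Cᵢ _ _ sub₂, Cⱼ _ _ sub₁, Cⱼ _ _ sub₂] at R₁₁
  have hl : (decide (gᵢ ∈ w₁.2.1) || decide (gᵢ ∈ w₂.2.1)) = true := by
    rcases mem_union.1 hgᵢ with h | h <;> simp [h]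
  have hm : (decide (gⱼ ∈ w₁.2.1) || decide (gⱼ ∈ w₂.2.1)) = true := by
    rcases mem_union.1 hgⱼ with h | h <;> simp [h]
  exact types_of_four_point _ _ _ _ _ _ _ _ hl hm R₀₀ R₁₀ R₀₁ R₁₁

end Types

end Summit.PneNP.PneNP.Theorems.PstarChordReadOutside
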